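import Summits.Ventures.PercRepro.ProfileBiIndepNormConsPairFree

/-!
# PercRepro — THE CONVERSE AT THE FREE MATROID: (NMP-I) GIVES EVERY (NC-pair) STEP WITH `M₁` FREE (p10, gen 30;
continues ProfileBiIndepNormConsPairFree)

`normConsPair_free_of_indepNMP`: under (NMP-I), for every finite matroid `M`, every up-set `U` of flats of the free
matroid on `gr M` (= every up-closed family of subsets) and every level `k`, the (NC-pair) step at `(free, M, U, k)`
holds: take `𝒜` = the complements of the level-`k` members of `U` that are mixed bi-independent (a family of independent
`(j+1)`-sets, `j = n − k − 1`); then `u_k(U) = #𝒜`, the complements of the shadow members lie in `U ∩ BI_{k+1}` (up-closure),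
so `u_{k+1}(U) ≥ #∂𝒜`, and `#BI_{k+1} = #I_j`, `#BI_k = #I_{j+1}` — the (NMP-I) inequality for `𝒜` is the step.
Together with `indepNMP_of_normConsPair`: **(NC-pair) restricted to `M₁` free is EQUIVALENT to (NMP-I)**
(`normConsPair_free_iff_indepNMP`).  Nothing here asserts (NC-pair) or (NMP-I).
-/

open scoped Matroid

namespace PercRepro.Cogirth

open Finset ThmH Skew

variable {α : Type} [DecidableEq α] {M : Matroid α} [M.Finite]

/-- The (NC-pair) steps with the first matroid free, as a predicate on `α`. -/
def NormConsPairFree (α : Type) [DecidableEq α] : Prop :=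
  ∀ (M : Matroid α) [M.Finite] (U : Finset (Finset α)),
    (haveI := freeOn_finite (gr M); UpFlats (Matroid.freeOn ((gr M : Finset α) : Set α)) U) → ∀ k : ℕ,
      haveI := freeOn_finite (gr M);
      mixedUpCount (Matroid.freeOn ((gr M : Finset α) : Set α)) M U k *
          (mixedBiIndepSets (Matroid.freeOn ((gr M : Finset α) : Set α)) M (k + 1)).card ≤
        mixedUpCount (Matroid.freeOn ((gr M : Finset α) : Set α)) M U (k + 1) *
          (mixedBiIndepSets (Matroid.freeOn ((gr M : Finset α) : Set α)) M k).card

/-- The mixed up-count at the free matroid counts the members of `U` among the mixed bi-independent sets. -/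
theorem mixedUpCount_freeOn_eq_card_filter (U : Finset (Finset α)) (i : ℕ) :
    haveI := freeOn_finite (gr M);
    mixedUpCount (Matroid.freeOn ((gr M : Finset α) : Set α)) M U i =
      ((mixedBiIndepSets (Matroid.freeOn ((gr M : Finset α) : Set α)) M i).filter (fun X => X ∈ U)).card := by
  haveI := freeOn_finite (gr M)
  unfold mixedUpCount
  congr 1
  apply filter_congr
  intro X hX
  have hXS : X ⊆ gr M := by
    unfold mixedBiIndepSets at hX
    rw [mem_filter, mem_powerset, gr_freeOn] at hX
    exact hX.1
  rw [clF_freeOn (gr M) hXS]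

/-- Membership in the mixed bi-independent sets of `(free, M)`. -/
theorem mem_mixedBiIndepSets_freeOn {i : ℕ} {X : Finset α} :
    haveI := freeOn_finite (gr M);
    X ∈ mixedBiIndepSets (Matroid.freeOn ((gr M : Finset α) : Set α)) M i ↔
      X ⊆ gr M ∧ X.card = i ∧ rk M (gr M \ X) = (gr M \ X).card := by
  haveI := freeOn_finite (gr M)
  unfold mixedBiIndepSets
  rw [mem_filter, mem_powerset, gr_freeOn]
  constructor
  · rintro ⟨h1, h2, -, h3⟩
    exact ⟨h1, h2, h3⟩
  · rintro ⟨h1, h2, h3⟩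
    exact ⟨h1, h2, rk_freeOn (gr M) h1, h3⟩

/-- Complementation in `gr M` is injective on subsets of `gr M`. -/
theorem sdiff_injOn_powerset (S : Finset α) {X X' : Finset α} (hX : X ⊆ S) (hX' : X' ⊆ S) (h : S \ X = S \ X') :
    X = X' := by
  have e : S \ (S \ X) = S \ (S \ X') := by rw [h]
  rwa [Finset.sdiff_sdiff_eq_self hX, Finset.sdiff_sdiff_eq_self hX'] at e

/-- **(NMP-I) ⟹ every (NC-pair) step with `M₁` free.** -/
theorem normConsPair_free_of_indepNMP (h : IndepNMP α) : NormConsPairFree α := by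
  intro M _ U hU k
  haveI := freeOn_finite (gr M)
  rcases Nat.lt_or_ge (gr M).card (k + 1) with hn | hn
  · -- no `(k+1)`-subsets of `gr M`: the left side vanishes
    have : mixedBiIndepSets (Matroid.freeOn ((gr M : Finset α) : Set α)) M (k + 1) = ∅ := by
      rw [eq_empty_iff_forall_notMem]
      intro X hX
      rw [mem_mixedBiIndepSets_freeOn] at hX
      have := card_le_card hX.1
      omega
    rw [this, card_empty, mul_zero]
    exact Nat.zero_le _
  -- the family: complements of the level-`k` members of `U`
  set 𝒜 := ((mixedBiIndepSets (Matroid.freeOn ((gr M : Finset α) : Set α)) M k).filter (fun X => X ∈ U)).image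
    (fun X => gr M \ X) with h𝒜
  have h𝒜sub : 𝒜 ⊆ indepSetsF M ((gr M).card - (k + 1) + 1) := by
    intro A hA
    rw [h𝒜, mem_image] at hA
    obtain ⟨X, hX, rfl⟩ := hA
    rw [mem_filter, mem_mixedBiIndepSets_freeOn] at hX
    rw [indepSetsF_eq, mem_filter, mem_powerset]
    refine ⟨sdiff_subset, ?_, hX.1.2.2⟩
    rw [card_sdiff_of_subset hX.1.1, hX.1.2.1]
    omega
  have hcard𝒜 : 𝒜.card = mixedUpCount (Matroid.freeOn ((gr M : Finset α) : Set α)) M U k := by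
    rw [mixedUpCount_freeOn_eq_card_filter, h𝒜, card_image_of_injOn]
    intro X hX X' hX' hXX'
    simp only [coe_filter, Set.mem_setOf_eq] at hX hX'
    rw [mem_mixedBiIndepSets_freeOn] at hX hX'
    exact sdiff_injOn_powerset (gr M) hX.1.1 hX'.1.1 hXX'
  -- the shadow members' complements lie in `U ∩ BI_{k+1}`
  have hshadow : (shadow 𝒜).card ≤ mixedUpCount (Matroid.freeOn ((gr M : Finset α) : Set α)) M U (k + 1) := by
    rw [mixedUpCount_freeOn_eq_card_filter]
    apply card_le_card_of_injOn (fun Z => gr M \ Z)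
    · intro Z hZ
      rw [mem_coe, mem_shadow_iff_exists_mem_card_add_one] at hZ
      obtain ⟨A, hA, hZA, hAc⟩ := hZ
      rw [h𝒜, mem_image] at hA
      obtain ⟨X, hX, rfl⟩ := hA
      rw [mem_filter, mem_mixedBiIndepSets_freeOn] at hX
      obtain ⟨⟨hXS, hXk, hXr⟩, hXU⟩ := hX
      have hZS : Z ⊆ gr M := hZA.trans sdiff_subset
      rw [mem_coe, mem_filter, mem_mixedBiIndepSets_freeOn]
      refine ⟨⟨sdiff_subset, ?_, ?_⟩, ?_⟩
      · rw [card_sdiff_of_subset hZS]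
        rw [card_sdiff_of_subset hXS] at hAc
        have := card_le_card hXS
        omega
      · rw [Finset.sdiff_sdiff_eq_self hZS]
        exact rk_eq_card_of_subset_of_rk_eq_card hZA hXr
      · -- `X ⊆ gr M ∖ Z` and `U` is up-closed among the flats (= subsets) of the free matroid
        have hXW : X ⊆ gr M \ Z := by
          intro x hx
          rw [mem_sdiff]
          refine ⟨hXS hx, fun hxZ => ?_⟩
          exact (mem_sdiff.1 (hZA hxZ)).2 hx
        exact hU.up X hXU (gr M \ Z) ((isFlatF_freeOn_iff (gr M) (gr M \ Z)).2 sdiff_subset) hXW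
    · intro Z hZ Z' hZ' hZZ'
      rw [mem_coe, mem_shadow_iff_exists_mem_card_add_one] at hZ hZ'
      obtain ⟨A, hA, hZA, -⟩ := hZ
      obtain ⟨A', hA', hZA', -⟩ := hZ'
      have hAS : A ⊆ gr M := by
        have := h𝒜sub hA
        rw [indepSetsF_eq, mem_filter, mem_powerset] at this
        exact this.1
      have hA'S : A' ⊆ gr M := by
        have := h𝒜sub hA'
        rw [indepSetsF_eq, mem_filter, mem_powerset] at this
        exact this.1
      exact sdiff_injOn_powerset (gr M) (hZA.trans hAS) (hZA'.trans hA'S) hZZ'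
  have hstep := h M ((gr M).card - (k + 1)) 𝒜 h𝒜sub
  rw [hcard𝒜] at hstep
  rw [card_mixedBiIndepSets_freeOn (i := k + 1) (by omega), card_mixedBiIndepSets_freeOn (i := k) (by omega)]
  have e : (gr M).card - k = (gr M).card - (k + 1) + 1 := by omega
  rw [e]
  calc mixedUpCount (Matroid.freeOn ((gr M : Finset α) : Set α)) M U k *
        (indepSetsF M ((gr M).card - (k + 1))).card
      ≤ (shadow 𝒜).card * (indepSetsF M ((gr M).card - (k + 1) + 1)).card := hstep
    _ ≤ mixedUpCount (Matroid.freeOn ((gr M : Finset α) : Set α)) M U (k + 1) *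
        (indepSetsF M ((gr M).card - (k + 1) + 1)).card := Nat.mul_le_mul_right _ hshadow

/-- (NC-pair) implies its free restriction. -/
theorem normConsPairFree_of_normConsPair (h : NormConsPair α) : NormConsPairFree α := by
  intro M _ U hU k
  haveI := freeOn_finite (gr M)
  exact h _ M (gr_freeOn (gr M)) U hU k

/-- **(NC-pair) restricted to a free first matroid is EQUIVALENT to (NMP-I).** -/
theorem normConsPairFree_iff_indepNMP : NormConsPairFree α ↔ IndepNMP α := by
  constructor
  · intro h M _ j 𝒜 h𝒜
    -- the argument of `indepNMP_of_normConsPair`, with only the free steps available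
    rcases Nat.lt_or_ge (gr M).card (j + 1) with hn | hn
    · have : indepSetsF M (j + 1) = ∅ := by
        unfold indepSetsF
        rw [powersetCard_eq_empty.2 hn, filter_empty]
      rw [this, subset_empty] at h𝒜
      subst h𝒜
      simp
    haveI := freeOn_finite (gr M)
    have hstep := h M (complUpset (gr M) 𝒜) (upFlats_complUpset (gr M) 𝒜) ((gr M).card - (j + 1))
    rw [mixedUpCount_freeOn_eq_card h𝒜 hn, mixedUpCount_freeOn_succ_eq_card_shadow h𝒜 hn,
      card_mixedBiIndepSets_freeOn (by omega), card_mixedBiIndepSets_freeOn (by omega)] at hstep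
    have e1 : (gr M).card - ((gr M).card - (j + 1) + 1) = j := by omega
    have e2 : (gr M).card - ((gr M).card - (j + 1)) = j + 1 := by omega
    rw [e1, e2] at hstep
    exact hstep
  · exact normConsPair_free_of_indepNMP

end PercRepro.Cogirth
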